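import Summits.Ventures.PercRepro.RankLevelSetFourCircuitNullityThree
import Summits.Ventures.PercRepro.S1CoreCapChain

/-!
# PercRepro — THE NULLITY-4 TOTAL CAP `s₄ ≤ 16` AND THE AVERAGING CHAIN FROM IT (p8 g7, S3)

`proofs/P8-S3-NULLITY3.md` §L4. From L3 (`s₄ ≤ 8` at nullity `3`, RankLevelSetFourCircuitNullityThree): deleting a point of
a quad, `s₄ ≤ Q*(4) + 8 = 16` on every `e`-free core of nullity `4` (`ncard_fourCircuits_le_sixteen_of_nullity_four`; the
tree's `capKer 4 = 18`), and the averaging chain from it — `avgChain16 = 0, 1, 5, 8, 16, 28, 46, 69, 99, 138, 188, 250, 326,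
419, 530, …` (`ncard_fourCircuits_le_avgChain16`; p2's `avgChain` is `18, 32, 53, 79, 114, 159, 216, 288, 376, 483, 611`).
Axioms: standard.
-/

open scoped Matroid

namespace PercRepro

namespace ThmN

open Set

variable {α : Type}

/-- **L4 — `s₄ ≤ 16` on every `e`-free core of nullity `4`** (the tree's `capKer 4 = 18`): a point of a quad deleted,
`Q*(4) = 8` plus L3 on the nullity-`3` core. -/
theorem ncard_fourCircuits_le_sixteen_of_nullity_four (M : Matroid α) [M.Finite]
    (hfree : ∀ e ∈ M.E, ∃ A ⊆ M.E \ {e}, e ∉ M.closure A ∧ e ∉ M.closure ((M.E \ {e}) \ A))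
    (hd : M.E.encard = M.eRank + 4) : {C : Set α | M.IsCircuit C ∧ C.ncard = 4}.ncard ≤ 16 := by
  rcases Nat.eq_zero_or_pos {C : Set α | M.IsCircuit C ∧ C.ncard = 4}.ncard with h0 | hpos
  · omega
  obtain ⟨C₀, hC₀⟩ : {C : Set α | M.IsCircuit C ∧ C.ncard = 4}.Nonempty := by
    rw [← Set.ncard_pos (fourCircuits_finite M)]; exact hpos
  have hC₀4 : C₀.ncard = 4 := hC₀.2
  obtain ⟨x, hxC⟩ : C₀.Nonempty := by
    rw [← Set.ncard_pos (M.ground_finite.subset hC₀.1.subset_ground), hC₀4]; norm_num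
  have hxE : x ∈ M.E := hC₀.1.subset_ground hxC
  have hxc : ¬ M.IsColoop x := hC₀.1.not_isColoop_of_mem hxC
  have hsplit := S1.ncard_fourCircuits_le_through_add_delete M x
  have hq := S1.ncard_fourCircuitsThrough_le_qKer 4 M hfree (by exact_mod_cast hd) x hxE
  have hq8 : S1.qKer 4 = 8 := by decide
  rw [hq8] at hq
  have hd' : M.E.encard = M.eRank + ((3 : ℕ) + 1) := by rw [hd]; norm_num
  have h8 := ncard_fourCircuits_le_eight_of_nullity_three (M ＼ {x}) (S1.hfree_delete M hfree x)
    (by have := delete_nullity_of_nonColoop M hd' hxE hxc; exact_mod_cast this)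
  omega

/-- **The averaging chain from the nullity-`4` cap `16`**: `0, 1, 5, 8, 16`, then `28` (`m = 9`), `46` (`m = 10`), then
`avgChain16 (n + 7) = ⌊(n + 12)·avgChain16 (n + 6)/(n + 8)⌋`: `69, 99, 138, 188, 250, 326, 419, 530, …` (p2's `avgChain`
is `18, 32, 53, 79, 114, 159, 216, 288, 376, 483, 611`). -/
def avgChain16 : ℕ → ℕ
  | 0 => 0
  | 1 => 1
  | 2 => 5
  | 3 => 8
  | 4 => 16
  | 5 => 28
  | 6 => 46
  | n + 7 => (n + 12) * avgChain16 (n + 6) / (n + 12 - 4)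

/-- The values `avgChain16 7 … 14 = 69, 99, 138, 188, 250, 326, 419, 530`. -/
theorem avgChain16_values : avgChain16 7 = 69 ∧ avgChain16 8 = 99 ∧ avgChain16 9 = 138 ∧ avgChain16 10 = 188 ∧
    avgChain16 11 = 250 ∧ avgChain16 12 = 326 ∧ avgChain16 13 = 419 ∧ avgChain16 14 = 530 := by decide

/-- **`s₄ ≤ avgChain16 ν` on every `e`-free core of nullity `ν`, unconditionally** — the kernel table at `ν ≤ 2`, L3 at
`ν = 3`, L4 at `ν = 4`, p2's averaging step with `m = 9, 10` at `ν = 5, 6` and p1's with `m = ν + 5` beyond. -/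
theorem ncard_fourCircuits_le_avgChain16 : ∀ (j : ℕ) (M : Matroid α) [M.Finite],
    (∀ e ∈ M.E, ∃ A ⊆ M.E \ {e}, e ∉ M.closure A ∧ e ∉ M.closure ((M.E \ {e}) \ A)) →
    M.E.encard = M.eRank + j → {C : Set α | M.IsCircuit C ∧ C.ncard = 4}.ncard ≤ avgChain16 j
  | 0, M, _, hfree, hd => (S1.ncard_fourCircuits_le_capKer M hfree hd).trans (by decide)
  | 1, M, _, hfree, hd => (S1.ncard_fourCircuits_le_capKer M hfree hd).trans (by decide)
  | 2, M, _, hfree, hd => (S1.ncard_fourCircuits_le_capKer M hfree hd).trans (by decide)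
  | 3, M, _, hfree, hd => ncard_fourCircuits_le_eight_of_nullity_three M hfree (by exact_mod_cast hd)
  | 4, M, _, hfree, hd => ncard_fourCircuits_le_sixteen_of_nullity_four M hfree (by exact_mod_cast hd)
  | 5, M, _, hfree, hd => by
    have hd' : M.E.encard = M.eRank + ((4 : ℕ) + 1) := by rw [hd]; norm_num
    have h := S1.ncard_fourCircuits_sub_div_le_of_nonColoops M hfree hd' (m := 9) (by norm_num)
      (S1.card_nonColoops_ge_nine M hfree (by exact_mod_cast hd)) (B := 16)
      (fun M' _ hfree' hd4 => ncard_fourCircuits_le_sixteen_of_nullity_four M' hfree' (by exact_mod_cast hd4))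
    show _ ≤ 28
    omega
  | 6, M, _, hfree, hd => by
    have hd' : M.E.encard = M.eRank + ((5 : ℕ) + 1) := by rw [hd]; norm_num
    have h := S1.ncard_fourCircuits_sub_div_le_of_nonColoops M hfree hd' (m := 10) (by norm_num)
      (S1.card_nonColoops_ge_ten M hfree (by exact_mod_cast hd)) (B := 28)
      (fun M' _ hfree' hd5 => ncard_fourCircuits_le_avgChain16 5 M' hfree' (by exact_mod_cast hd5))
    show _ ≤ 46
    omega
  | n + 7, M, _, hfree, hd => by
    have hd' : M.E.encard = M.eRank + ((n + 6 : ℕ) + 1) := by rw [hd]; push_cast; ring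
    have h := S1.ncard_fourCircuits_sub_div_le M hfree (d := n + 6) hd' (by omega)
      (fun M' _ hfree' hd6 => ncard_fourCircuits_le_avgChain16 (n + 6) M' hfree' hd6)
    have h2 := S1.le_mul_div_of_sub_div_le (m := n + 12) (by omega) h
    show _ ≤ (n + 12) * avgChain16 (n + 6) / (n + 12 - 4)
    exact h2

end ThmN

end PercRepro
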